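import Summits.QuantumFields.QCD.Theses.WilsonQuarkChessboard
import Summits.QuantumFields.QCD.Theorems.SpectralDefectExtinctionChiralDescentSharedChiralItems

/-!
# `WilsonQuarkChessboard.ChiralDescent` (crux stmt-QuantumFields-17578) — its dependency edges to the EXISTING chiral
# items of the sub-problem `QCD`, kernel-checked BY NAME (line `registered` = `Cruxes/ChiralDescent/Lines/birth.lean`,
# line lead cycle 1, 2026-08-17)

The crux (route WilsonQuarkChessboard, rank 7; child 2 of the former `DominationBridge`) reads
`(∀ N_f ∈ {2,3}, ∃ M₀ ≥ 0, ∃ reg mass-scaling, body above M₀) → QCD`, `QCD = QCDOf 2 ∧ QCDOf 3`, where the per-tuple BODY is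
the full body of the re-typed conjunct `QCDOf` (OS data with `IsQCDAlong`, non-trivial non-Gaussian glue, non-decoupled
flavour-changing pseudoscalars, one rate `Δ > 0` for `T.HasMassGap` and `HasLatticeMassGap`).  Its registered line skeleton
(`Birth.ChiralDescent_of`, sorries = the two stubs `stub_lightQuarkContinuation`, `stub_chiralPointOfBodyEverywhere`) is the
infimum descent already reduced for the sibling crux stmt-QuantumFields-17527 `SpectralDefectExtinction.ChiralDescent`.

This file records, WITHOUT any new definition and without re-proving anything landed, that the crux and both of its stubs are
NOT new debts: each is implied by (or is) an item already on the ledger, so that whichever upstream item lands first closes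
stmt-17578 by ONE application of a theorem below, and no planner files the stubs again.

* `chiralDescent_of_chiralCompletion` — the shared item stmt-QuantumFields-17394 `QuarksAsStableAction.ChiralCompletion`
  (= `SeaNonGibbs.ChiralCompletion`: per flavour number, threshold ⇒ `QCDOf N_f`, with the SAME quantifier order
  `∃ M₀ ≥ 0, ∃ reg` as this crux) gives the crux by instantiating at `N_f = 2, 3`.  (The crux is logically WEAKER: it bundles
  both thresholds before concluding; nothing flows back.)
* `chiralDescent_of_spectralDefectExtinction` — the sibling crux stmt-QuantumFields-17527 (`∃ reg, ∃ M₁ ≥ 0` order) gives it,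
  through the landed `chiralDescent_iff_chiralCompletion` (p139859).
* `chiralDescent_of_massContinuation_of_chiralTupleGapless` — items stmt-QuantumFields-18327 `MassContinuation` ∧
  stmt-QuantumFields-18328 `ChiralTupleGapless` (route QuarksAsStableAction) give it (landed edge of p139859, then the above).
* `chiralDescent_of_sameRegChiralCompletion` — item stmt-QuantumFields-17661 `HeavyThresholdYMBridge.ChiralCompletion`
  (same-regularisation form; text verbatim as the hypothesis, that route file is not imported) gives it.
* `lightQuarkContinuation_iff_massContinuation` — the line's load-bearing stub `stub_lightQuarkContinuation` (signature
  verbatim on the left) IS item stmt-QuantumFields-18327, up to currying the rate `∃ ε > 0`.  (Stub 2,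
  `stub_chiralPointOfBodyEverywhere`, follows from item 18328: landed `chiralPointOfBodyEverywhere_of_chiralTupleGapless`,
  p139859 — not repeated here.)
* `chiralDescent_of_lightQuarkContinuation_of_chiralPointOfBodyEverywhere` — the skeleton's composition with the two stub
  signatures as hypotheses and the crux BY NAME as conclusion (the BC3 letter as a citable theorem): when both stubs land as
  theorems, the crux closes by this one line; equivalently by `chiralDescent_of_massContinuation_of_chiralTupleGapless`.

All implications are CONDITIONAL on the named items (open-problem class: light-quark continuation of the massive
construction below a uniformly gapped offset + OS-level gaplessness at the chiral point — Goldstone/GMOR on the χSB branch,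
't Hooft anomaly matching otherwise; barriers `Literature.Barriers.QuantumFields.AnomalyMatching` / `GoldstoneTheorem` bar
only the refutation direction).  That is the point: they are the ledger's dependency edges for stmt-17578.
Pure logic over `QCDOS.lean` and the landed sibling files; standard axioms.
-/

namespace Summit.QuantumFields.QCD.Cruxes.ChiralDescent.Birth

open Filter
open Literature.MathematicalPhysics.QuantumFieldTheory
open Summit.QuantumFields.QCD
open Summit.QuantumFields.QCD.Cruxes.ChiralDescent.InfimumDescent

variable {Nf : ℕ}

/-! ## §1 The crux from the shared item stmt-QuantumFields-17394 -/

/-- **Item stmt-QuantumFields-17394 `QuarksAsStableAction.ChiralCompletion` ⇒ this crux.**  The shared chiral item says,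
per flavour number `N_f ∈ {2,3}`: `(∃ M₀ ≥ 0, ∃ reg mass-scaling, body above M₀) → QCDOf N_f` — literally the per-`N_f`
form of this crux's hypothesis and conclusion; instantiate at `N_f = 2` and `N_f = 3` and pair the results
(`QCD = QCDOf 2 ∧ QCDOf 3`).  CONDITIONAL on item 17394 (open-problem class). [folklore] -/
theorem chiralDescent_of_chiralCompletion (h : Theses.QuarksAsStableAction.ChiralCompletion) :
    Theses.WilsonQuarkChessboard.ChiralDescent := by
  unfold Theses.QuarksAsStableAction.ChiralCompletion at h
  intro hT
  exact ⟨h 2 (Or.inl rfl) (hT 2 (Or.inl rfl)), h 3 (Or.inr rfl) (hT 3 (Or.inr rfl))⟩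

/-- **The sibling crux stmt-QuantumFields-17527 `SpectralDefectExtinction.ChiralDescent` ⇒ this crux** (the two differ in
the order `∃ reg` / `∃ M₀ ≥ 0` of the threshold hypothesis and in where `∀ N_f` sits; through the landed
`chiralDescent_iff_chiralCompletion`, p139859).  CONDITIONAL on item 17527. [folklore] -/
theorem chiralDescent_of_spectralDefectExtinction (h : Theses.SpectralDefectExtinction.ChiralDescent) :
    Theses.WilsonQuarkChessboard.ChiralDescent :=
  chiralDescent_of_chiralCompletion (chiralDescent_iff_chiralCompletion.mp h)

/-! ## §2 The crux from the pieces: items stmt-QuantumFields-18327 ∧ 18328, item stmt-QuantumFields-17661 -/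

/-- **Items stmt-QuantumFields-18327 `QuarksAsStableAction.MassContinuation` ∧ stmt-QuantumFields-18328
`QuarksAsStableAction.ChiralTupleGapless` ⇒ this crux**, through the landed edge
`chiralDescent_of_massContinuation_of_chiralTupleGapless` for the sibling crux (p139859: the gapless tuple discharges the
FINITENESS branch of the infimum descent, OPENNESS is mass continuation verbatim).  CONDITIONAL on the two items
(open-problem class). [folklore] -/
theorem chiralDescent_of_massContinuation_of_chiralTupleGapless
    (hO : Theses.QuarksAsStableAction.MassContinuation) (hG : Theses.QuarksAsStableAction.ChiralTupleGapless) :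
    Theses.WilsonQuarkChessboard.ChiralDescent :=
  chiralDescent_of_spectralDefectExtinction (InfimumDescent.chiralDescent_of_massContinuation_of_chiralTupleGapless hO hG)

/-- **Item stmt-QuantumFields-17661 `HeavyThresholdYMBridge.ChiralCompletion` ⇒ this crux** (same-regularisation form:
some constant re-pin `m ↦ m + δ` of the threshold regularisation is chiral at zero and carries the body at every positive
tuple; its text is the hypothesis verbatim, so that route file is not imported), through the landed
`chiralDescent_of_sameRegChiralCompletion` for the sibling crux (p139859).  CONDITIONAL on item 17661. [folklore] -/
theorem chiralDescent_of_sameRegChiralCompletion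
    (h : ∀ Nf : ℕ, Nf = 2 ∨ Nf = 3 → ∀ (reg : QCDRegularisation Nf) (M₀ : ℝ), reg.HasMassScaling →
      (∀ m : Fin Nf → ℝ, (∀ f, M₀ < m f) →
        ∃ (z shift : QCDField Nf → ℕ → ℝ) (T : OSData (QCDField Nf) 4),
          IsQCDAlong (reg.scheme m z shift) T ∧ T.IsNontrivial QCDField.glue ∧ T.IsNonGaussian QCDField.glue ∧
            (∀ f g : Fin Nf, f ≠ g → T.IsNontrivial (QCDField.pseudoRe f g)) ∧
              ∃ Δ > 0, T.HasMassGap Δ ∧ (reg.scheme m z shift).HasLatticeMassGap Δ) →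
      ∃ δ : ℝ, (∀ ε > (0 : ℝ), ∃ m : Fin Nf → ℝ, (∀ f, 0 < m f) ∧
          ¬ (reg.scheme (fun f => m f + δ) 0 0).HasLatticeMassGap ε) ∧
        ∀ m : Fin Nf → ℝ, (∀ f, 0 < m f) →
          ∃ (z shift : QCDField Nf → ℕ → ℝ) (T : OSData (QCDField Nf) 4),
            IsQCDAlong (reg.scheme (fun f => m f + δ) z shift) T ∧ T.IsNontrivial QCDField.glue ∧
              T.IsNonGaussian QCDField.glue ∧
                (∀ f g : Fin Nf, f ≠ g → T.IsNontrivial (QCDField.pseudoRe f g)) ∧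
                  ∃ Δ > 0, T.HasMassGap Δ ∧ (reg.scheme (fun f => m f + δ) z shift).HasLatticeMassGap Δ) :
    Theses.WilsonQuarkChessboard.ChiralDescent :=
  chiralDescent_of_spectralDefectExtinction (InfimumDescent.chiralDescent_of_sameRegChiralCompletion h)

/-! ## §3 The registered stubs against the existing items -/

/-- **Stub 1 `stub_lightQuarkContinuation` ⇔ item stmt-QuantumFields-18327 `QuarksAsStableAction.MassContinuation`.**
The line's load-bearing stub (signature verbatim on the left: body above `μ` + ONE uniform lattice rate above `μ` ⇒ body
above `μ − δ`, for `N_f ∈ {2,3}`, every mass-scaling regularisation, every offset) is that crux item with the rate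
`∃ ε > 0` curried into the hypotheses — so the stub is proved exactly when item 18327 is, and would duplicate it as an item.
[folklore] -/
theorem lightQuarkContinuation_iff_massContinuation :
    (∀ Nf : ℕ, (Nf = 2 ∨ Nf = 3) → ∀ reg : QCDRegularisation Nf, reg.HasMassScaling → ∀ μ : ℝ,
      (∀ m : Fin Nf → ℝ, (∀ f, μ < m f) →
        ∃ (z shift : QCDField Nf → ℕ → ℝ) (T : OSData (QCDField Nf) 4),
          IsQCDAlong (reg.scheme m z shift) T ∧ T.IsNontrivial QCDField.glue ∧ T.IsNonGaussian QCDField.glue ∧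
            (∀ f g : Fin Nf, f ≠ g → T.IsNontrivial (QCDField.pseudoRe f g)) ∧
              ∃ Δ > 0, T.HasMassGap Δ ∧ (reg.scheme m z shift).HasLatticeMassGap Δ) →
      (∃ ε > (0 : ℝ), ∀ m : Fin Nf → ℝ, (∀ f, μ < m f) → (reg.scheme m 0 0).HasLatticeMassGap ε) →
      ∃ δ > (0 : ℝ), ∀ m : Fin Nf → ℝ, (∀ f, μ - δ < m f) →
        ∃ (z shift : QCDField Nf → ℕ → ℝ) (T : OSData (QCDField Nf) 4),
          IsQCDAlong (reg.scheme m z shift) T ∧ T.IsNontrivial QCDField.glue ∧ T.IsNonGaussian QCDField.glue ∧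
            (∀ f g : Fin Nf, f ≠ g → T.IsNontrivial (QCDField.pseudoRe f g)) ∧
              ∃ Δ > 0, T.HasMassGap Δ ∧ (reg.scheme m z shift).HasLatticeMassGap Δ) ↔
    Theses.QuarksAsStableAction.MassContinuation := by
  unfold Theses.QuarksAsStableAction.MassContinuation
  constructor
  · intro h Nf hNf reg M ε hMS hε hB hgap
    exact h Nf hNf reg hMS M hB ⟨ε, hε, hgap⟩
  · rintro h Nf hNf reg hMS μ hB ⟨ε, hε, hgap⟩
    exact h Nf hNf reg μ ε hMS hε hB hgap

/-- **The crux BY NAME from the two registered stub signatures** (hypotheses form of the skeleton's composition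
`Birth.ChiralDescent_of`; through the landed sibling composition `chiralDescent_of_openness_of_finiteChiralPoint`, p134498,
whose hypotheses are the two stub signatures verbatim).  When `stub_lightQuarkContinuation` (= item 18327) and
`stub_chiralPointOfBodyEverywhere` (⇐ item 18328) are theorems, stmt-17578 closes by this line.  CONDITIONAL on the stubs.
[folklore] -/
theorem chiralDescent_of_lightQuarkContinuation_of_chiralPointOfBodyEverywhere
    (h1 : ∀ Nf : ℕ, (Nf = 2 ∨ Nf = 3) → ∀ reg : QCDRegularisation Nf, reg.HasMassScaling → ∀ μ : ℝ,
      (∀ m : Fin Nf → ℝ, (∀ f, μ < m f) →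
        ∃ (z shift : QCDField Nf → ℕ → ℝ) (T : OSData (QCDField Nf) 4),
          IsQCDAlong (reg.scheme m z shift) T ∧ T.IsNontrivial QCDField.glue ∧ T.IsNonGaussian QCDField.glue ∧
            (∀ f g : Fin Nf, f ≠ g → T.IsNontrivial (QCDField.pseudoRe f g)) ∧
              ∃ Δ > 0, T.HasMassGap Δ ∧ (reg.scheme m z shift).HasLatticeMassGap Δ) →
      (∃ ε > (0 : ℝ), ∀ m : Fin Nf → ℝ, (∀ f, μ < m f) → (reg.scheme m 0 0).HasLatticeMassGap ε) →
      ∃ δ > (0 : ℝ), ∀ m : Fin Nf → ℝ, (∀ f, μ - δ < m f) →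
        ∃ (z shift : QCDField Nf → ℕ → ℝ) (T : OSData (QCDField Nf) 4),
          IsQCDAlong (reg.scheme m z shift) T ∧ T.IsNontrivial QCDField.glue ∧ T.IsNonGaussian QCDField.glue ∧
            (∀ f g : Fin Nf, f ≠ g → T.IsNontrivial (QCDField.pseudoRe f g)) ∧
              ∃ Δ > 0, T.HasMassGap Δ ∧ (reg.scheme m z shift).HasLatticeMassGap Δ)
    (h2 : ∀ Nf : ℕ, (Nf = 2 ∨ Nf = 3) → ∀ reg : QCDRegularisation Nf, reg.HasMassScaling →
      (∀ m : Fin Nf → ℝ,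
        ∃ (z shift : QCDField Nf → ℕ → ℝ) (T : OSData (QCDField Nf) 4),
          IsQCDAlong (reg.scheme m z shift) T ∧ T.IsNontrivial QCDField.glue ∧ T.IsNonGaussian QCDField.glue ∧
            (∀ f g : Fin Nf, f ≠ g → T.IsNontrivial (QCDField.pseudoRe f g)) ∧
              ∃ Δ > 0, T.HasMassGap Δ ∧ (reg.scheme m z shift).HasLatticeMassGap Δ) →
      ∃ μ : ℝ, ∀ ε > (0 : ℝ), ∃ m : Fin Nf → ℝ, (∀ f, μ < m f) ∧ ¬ (reg.scheme m 0 0).HasLatticeMassGap ε) :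
    Theses.WilsonQuarkChessboard.ChiralDescent :=
  chiralDescent_of_spectralDefectExtinction (chiralDescent_of_openness_of_finiteChiralPoint h1 h2)

/-- **The crux from stub 1's upstream item and stub 2 as stated** (the mixed form a planner meets if 18327 lands first:
then only `stub_chiralPointOfBodyEverywhere` remains).  CONDITIONAL. [folklore] -/
theorem chiralDescent_of_massContinuation_of_chiralPointOfBodyEverywhere
    (hO : Theses.QuarksAsStableAction.MassContinuation)
    (h2 : ∀ Nf : ℕ, (Nf = 2 ∨ Nf = 3) → ∀ reg : QCDRegularisation Nf, reg.HasMassScaling →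
      (∀ m : Fin Nf → ℝ,
        ∃ (z shift : QCDField Nf → ℕ → ℝ) (T : OSData (QCDField Nf) 4),
          IsQCDAlong (reg.scheme m z shift) T ∧ T.IsNontrivial QCDField.glue ∧ T.IsNonGaussian QCDField.glue ∧
            (∀ f g : Fin Nf, f ≠ g → T.IsNontrivial (QCDField.pseudoRe f g)) ∧
              ∃ Δ > 0, T.HasMassGap Δ ∧ (reg.scheme m z shift).HasLatticeMassGap Δ) →
      ∃ μ : ℝ, ∀ ε > (0 : ℝ), ∃ m : Fin Nf → ℝ, (∀ f, μ < m f) ∧ ¬ (reg.scheme m 0 0).HasLatticeMassGap ε) :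
    Theses.WilsonQuarkChessboard.ChiralDescent :=
  chiralDescent_of_lightQuarkContinuation_of_chiralPointOfBodyEverywhere
    (lightQuarkContinuation_iff_massContinuation.mpr hO) h2

end Summit.QuantumFields.QCD.Cruxes.ChiralDescent.Birth
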